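import Mathlib
import Literature.MathematicalPhysics.QuantumFieldTheory.Balaban1983to89.B6CoverRealizes

/-!
# `Balaban1983to89.B6LevelTower` — a COORDINATISED k-LEVEL CARRIER (k + 1 ≥ 3 levels) on which condition (2.2) and the
level gap behind (2.57) ∕ (2.60) have CONTENT: the tower of boxes B⁰(Λ₀), B¹(Λ₁), …, B^k(Λ_k) glued along one interface
wall per consecutive pair, built as a contour system of `…B6Geometry` realising the multiscale distance (2.46); on it the
printed (2.2) *"(L^jη)^{−1} dist(Ω_j^c, Ω_{j+1}) > RM"* holds IFF RM·L < (a + 1)·L + 1 (a + 1 = the Λ_j-thickness of the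
level-j block across the wall direction), the walk form of (2.2) holds with the SHARP constant a + 1 (and fails with
a + 2), (2.60) ∕ `…B6Ineq268.LevelSep` hold with R·M ≤ a + 1 — R > 0 LOAD-BEARING — and FAIL with R·M > a + 2
(B6 = T. Bałaban, *Propagators and renormalization transformations for lattice gauge theories. II*, Commun. Math. Phys.
**96**, 223–250 (1984) [Balaban1984PropagatorsII]).

CITATION HEADER (lean-in-tree rule 2026-08-18).  Cell `pub-balaban`, unit `b2b-balaban-b06-g20` (paper sub-cell B06,
gen 20 — the owner lineage of `…B6CoverBox` (gen 17), `…B6CoverTwoLevel` (gen 18), `…B6CoverRealizes` (gen 19), which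
this NEW LEAF imports and does not modify; it reuses BY NAME the typed (2.46) of `…B6Geometry` (`ContourSystem`,
`Realizes`, `Separates`, `LevelGap`, `levelGap_dist_real`, `hyps266_of_realizes`, `ineq260_of_levelGap`), the metric
form of (2.2) of `…B6LevelGapMetric` (`BondScale`, `ZoneSep`, `levelGap_of_metric`, `BondScale22`, `Cond22`,
`levelGap_of_cond22`, `ineq260_of_cond22`, `ZonesOf`, `SetSep22`, `setSep_iff_zoneSep`), the box charts ∕ atlases of
`…B6BoxCharts` (`IsBoxChart`, `Atlas`, `connected_of_atlas`, `dist_le_latL1Dist_of_chart`) — all of the pv08 lineage —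
the index vocabulary `zv`, `clampBox` of `…B6CoverTwoLevel`, and `…B6Ineq268` (`LevelSep`, `mx`,
`levelSep_iff_ineq260`), all imported through `…B6CoverRealizes`).  Source: [B6] doi:10.1007/bf01240221, held
`paper:balaban1984-cmp96-propagators-rt-ii`, journal page = PDF page + 222; the quotations of pp. 224, 231, 232, 233, 234
below were read from the page renders `b2b-balaban-ref1/pages/1984-cmp96-propagators-rt-II/
1984-cmp96-propagators-rt-II-p002, p009, p010, p011, p012-x2.png` AS IMAGES this gen.  Cell rows: GAPS C-b06g20-1 (this
module), DIVERGENCE D-b06.40; census `HOME/b2b-balaban-b06-g19/CENSUS-B6-v1.5.md` (§2 rows (2.1)–(2.4) ∕ (2.2), §6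
hypothesis H-B6.5 "k-level geometry letter-level"; gen-19 menu item (b)), which this module addresses; journal claim
LEVEL-TOWER.

THE PRINTED TEXT.  [B6] p. 224 [PDF 2]: *"We consider a sequence of domains Ω₁ ⊃ Ω₂ ⊃ … ⊃ Ω_k, Ω_j ⊂ T_η, j = 1, 2, …,
k, (2.1) which satisfy the following conditions: Ω_j = B^j(Ω_j^{(j)}), Ω_j^{(j)} ⊂ T^{(j)}_{L^jη} and it is a sum of
big blocks, (L^jη)^{−1} dist(Ω^c_j, Ω_{j+1}) > RM, M is a size of big blocks and R is a big positive integer which will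
be fixed later. (2.2)"*; *"Λ_j = Ω_j^{(j)}∖Ω^{(j)}_{j+1}, j = 1, …, k − 1, Λ_k = Ω_k^{(k)}, Λ₀ = Ω^c_1 (2.3)"*; *"Ω₁ =
⋃_{j=1}^k B^j(Λ_j), T = ⋃_{j=0}^k B^j(Λ_j), where B⁰(Λ₀) = Λ₀. (2.4)"*.  p. 231 [PDF 9]: *"𝔅 = ⋃_{j=0}^k Λ_j. (2.45)
We will identify this set with the set of corresponding blocks. For an arbitrary contour Γ on the lattice T_η we put
|Γ| = nη, where n is a number of bonds the contour Γ consists of. We will define a new distance between two points of 𝔅.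
We consider a special class of contours Γ. They have the property that a part of Γ contained in B^j(Λ_j) consists of
bonds of the lattice Λ_j. Now we define d(y, y′) = inf_{Γ_{y,y′}} Σ_{j=0}^k (L^jη)^{−1}|Γ_{y,y′} ∩ B^j(Λ_j)|, y, y′ ∈ 𝔅,
(2.46) where the infimum is taken over all admissible contours described above, with end-points y, y′."* … *"The domain
Ω_j is a sum of cubes of the size ML^jη. A sum of faces of these cubes which are not contained in the interior of Ω_j
forms a surface. We denote this surface by Σ_j … The surface Σ_j separates the sets B^j(Λ_j) and B^{j−1}(Λ_{j−1}). …
Of course the infimum is attained at some contour Γ_{y,y′}."*  p. 232 [PDF 10], (2.48): *"d(y, y′) ≥ (L^jη)^{−1}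
|Γ_{y,y₁}| + Σ_{l=1}^m (L^{j_l}η)^{−1}|Γ_{y_l,y′_l}| + Σ_{l=1}^m (L^{j_{l,l+1}}η)^{−1}|Γ_{y′_l,y_{l+1}}| ≥ (L^jη)^{−1}
|y − y₁| + Σ_{l=1}^m (L^{j_l}η)^{−1}|y_l − y′_l| + Σ_{l=1}^m (L^{j_{l,l+1}}η)^{−1}|y′_l − y_{l+1}|. (2.48)"*  p. 233
[PDF 11]: *"From the condition (2.2) and from the definition of the points y′_l, y_{l+1}, more exactly from the fact that
they belong to different surfaces Σ_j, we have (L^{j_{l,l+1}}η)^{−1}|y′_l − y_{l+1}| > RM. (2.57)"*, and the lower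
summation index *"m = max{|j − j′| − 1, 0}"* of (2.58).  p. 234 [PDF 12], Lemma 2.1: *"e^{−αδ₀d(y,y′)} ≤
e^{−αδ₀RM max{|j−j′|−1,0}}, y ∈ Λ_j, y′ ∈ Λ_{j′}, (2.60)"*.

THE POINT.  The tree types (2.2) and its consequences abstractly — the walk form `…B6Geometry.LevelGap` (every admissible
contour from a point below Σ_i-level to a point above it has more than N bonds), the metric form `…B6LevelGapMetric.Cond22`
((2.2) on the lattice points of a drawing) with `levelGap_of_cond22`, and (2.60) `ineq260_of_levelGap` ∕
`ineq260_of_cond22` ∕ `…B6Ineq268.LevelSep` — and every COORDINATISED model in the tree has at most two levels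
(`…B6CoverBox.boxGeo`: one; `…B6CoverTwoLevel.tlGeo` and `…B6BoxCharts.twoScaleGraph`: two adjacent), where both forms
of (2.2) are VACUOUS (no zone strictly between two zones: `…B6CoverRealizes.tlCS_cond22` holds for EVERY drawing and
`tlCS_levelGap` for EVERY N) and (2.60) degenerates to e⁰ = 1 (`…B6CoverTwoLevel.tlGeo_mx_eq_zero`).  So the chain (2.2) ⇒ (2.57) ⇒
(2.60) with R > 0 had never been exercised on a model where its hypothesis says something.  THIS MODULE builds the
smallest honest such model — the LEVEL TOWER: for j = 0, …, k a box of (a + 1)^d points of Λ_j (own lattice spacing L^j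
in Λ₀-units), consecutive boxes glued by one wall of interface Λ_j-bonds (the far face {x₀ = a} of the level-j box to the
near face {x₀ = 0} of the level-(j+1) box, transverse coordinates matched x_μ = L·x′_μ — the points of Λ_{j+1} ∩ Σ_{j+1}
sit on the sublattice LΛ_j), drawn in ℝ^d at x ↦ η·(off_j + L^j x₀, L^j x₁, …) with off_{j+1} = off_j + (a + 1)L^j — and
proves on it, with every constant explicit: the realisation of (2.46) (`rfl`), connectivity from a (k + 1)-chart atlas,
Σ_j separates, (len) with EQUALITY (each admissible bond of B^j has extent exactly L^jη), **(2.2) ⟺ RM·L < (a + 1)L + 1**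
(`twCS_cond22_iff`; the witness pair for the failure: the far corner of level 0 and the near corner of level 2, at
distance ((a + 1)L + 1)η across the level-1 block), the walk form **`LevelGap (a + 1)` and `¬ LevelGap (a + 2)`** (the
contour corner₀ → wall → a bonds across level 1 → wall → corner₂ has a + 2 bonds and none has fewer:
`dist_wall2_eq`), the level-distance bound (a + 1)·max{|j − j′| − 1, 0} ≤ d(y, y′), **(2.60) and `LevelSep` for
R·M ≤ a + 1 and their FAILURE for R·M > a + 2**, (2.60) once more by the printed-shape route `ineq260_of_cond22` with
(2.2) a hypothesis that `twCS_cond22` DISCHARGES, the set form (2.1)∕(2.3)∕(2.4) of the domains Ω_j = {levels ≥ j} with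
(2.2) at set level (`twCS_setSep22`), the in-box comparison d ≤ ‖Δx‖₁ of (2.66), and a numerical instance (d = 1, three
levels, a = 5, M = 2, L = 2, η = 1: R = 3 passes every test, R = 4 fails every test).

WHAT THIS MODULE PROVES (kernel-checked; no `sorry`, no axiom beyond Lean's three):
1. §1 the carrier `TW d k a` = Fin (k+1) × {0,…,a}^d, the level map `lvl`, the wall offsets `off` (`off_succ`,
   `off_mono`, the gap lemma `off_gap`: off_z + aL^z + L^n ≤ off_{n+1} for z ≤ n), the position `pos` (Λ₀-units, ℤ^d),
   the bonds (own-level Λ_j-bonds; wall bonds) and the bond graph `graph`; **one bond moves exactly one coordinate, by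
   exactly L^{min(j,j′)}** (`pos_step`); `lvl_of_bond`, `graph_separates` (Σ_{j+1} separates); the x₀-range of a
   level (`off_le_pos_zero`, `pos_zero_le`) and the x₀-gap across a full level (`pos_zero_gap`: (a+1)L^{n+1} + L^n);
   the far corner `cornerA` and the corner wall bond `adj_wall`.
2. §2 the (k+1)-chart atlas `twAtlas` (one box chart per level, `chart_lvl`), `twAtlas_covers`, consecutive charts linked
   by the corner wall bond (`twAtlas_linked`, `twAtlas_nerve_adj`), the nerve a path (`twAtlas_nerve_reachable`,
   `twAtlas_nerve_preconnected`), hence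
   `graph_connected` (*"Of course the infimum is attained"*); the graph distance `tdist` and its pseudo-metric axioms;
   the in-level comparison `dist_le_latL1Dist_of_lvl`; `latL1Dist_zero_cornerA` = a; `dist_wall2_le` (≤ a + 2).
3. §3 the drawing `tposR` (sup metric of ℝ^d): `dist_tposR_eq` (= L^{min}η on bonds), `bondScale_tposR` ((len)),
   `dist_tposR_ge` (≥ η((a+1)L^{n+1} + L^n) across level n + 1), **`zoneSep_tposR`** ((2.2) with threshold T whenever
   T·L < (a+1)L + 1), `dist_tposR_wall2_le` (the corner pair across level 1 is ≤ η((a+1)L + 1) apart) and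
   **`not_zoneSep_tposR`** (failure when (a+1)L + 1 ≤ T·L, k ≥ 2),
   `zoneSep_tposR_iff`; **`graph_levelGap`** (`LevelGap (a+1)`, via `levelGap_of_metric` at η = 1), `dist_wall2_eq`
   (= a + 2), **`graph_not_levelGap`** (`¬ LevelGap (a+2)`), `dist_ge_levels` ((a+1)(|j−j′|−1)⁺ ≤ d).
4. §4 the domains `dom j` = {lvl ≥ j}: `zonesOf_dom` ((2.3)–(2.4) dictionary), `dom_antitone` ((2.1)), `dom_zero`
   (T = everything), `dom_succ_top` (nothing above level k), `dom_diff_succ` ((2.3): Λ_j = Ω_j ∖ Ω_{j+1} = level j),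
   `setSep_dom_iff` ((2.2) at set level ⟺ on points).
5. §5 the geometry `twGeo` (Site = TW, scale = lvl, dist = tdist, M = m, R, L, η, k) and contour system `twCS`;
   `twGeo_realizes` (`rfl`), `twCS_connected`, `twCS_separates`, `twCS_bondScale22`, **`twCS_cond22`** (RML < (a+1)L+1),
   `twCS_cond22_of_le` (RM ≤ a+1), **`twCS_not_cond22`**, **`twCS_cond22_iff`**, `twCS_levelGap` (a+1),
   `twCS_levelGap_of_cond22` (the printed route, any N ≤ RM), `twCS_not_levelGap` (a+2), `twGeo_isPseudoDist`,
   `twGeo_hyps266`, `twGeo_dist_ge_levels`, **`twGeo_levelSep`** (RM ≤ a+1) and **`twGeo_not_levelSep`** (a+2 < RM),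
   **`twGeo_ineq260`** (RM ≤ a+1, αδ₀ ≥ 0), `twGeo_ineq260_of_cond22` (printed-shape route, RM = N ∈ ℕ),
   **`twGeo_not_ineq260`** (a+2 < RM, αδ₀ > 0), `twCS_setSep22`, `twGeo_ineq260_of_setSep22`, `twGeo_dist_le_latL1Dist`,
   `twGeo_mx_wall2` (the exponent max{|j−j′|−1,0} = 1 IS ATTAINED).
6. §6 `levelTower_nonvacuous`: on (d, k, a, M, L, η) = (1, 2, 5, 2, 2, 1) — three levels — R = 3 gives (2.2), the walk
   form with N = 6, `LevelSep` and (2.60) at αδ₀ = ½, while R = 4 refutes (2.2), `LevelSep` and (2.60), and N = 7 refutes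
   the walk form: every hypothesis named in §5 is simultaneously satisfiable AND each conclusion is non-trivial there.

TYPING ∕ DIVERGENCE (D-b06.40).  (a) GEOMETRY OF THE MODEL: the printed Ω_j are nested sums of big blocks in a torus and
Λ_j = Ω_j^{(j)} ∖ Ω_{j+1}^{(j)} is a shell; the tower replaces each shell by ONE box and each surface Σ_{j+1} by ONE wall
(the model is a "core sample" through the nest along the x₀-axis).  What (2.2) ∕ (2.57) ∕ (2.60) see — a contour from
below Σ_j to above Σ_{j+1} must cross the full Λ_j-thickness of B^j(Λ_j) — is exactly what the tower retains; tangential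
geometry, corners of the nest and the torus are NOT modelled.  (b) (2.2) reads dist(Ω_j^c, Ω_{j+1}) on LATTICE POINTS of
the drawing (`…B6LevelGapMetric.Cond22`, sup metric of ℝ^d), as in the siblings; in the tower dist(Ω_j^c, Ω_{j+1}) ≥
((a+1)L^j + L^{j−1})η (`dist_tposR_ge`), with equality at the corner pair (proved as an upper bound for j = 1,
`dist_tposR_wall2_le`), whence the level-independent threshold RM < a + 1 + 1∕L (`twCS_cond22_iff`) — for the printed
integers R, M and L ≥ 2 this is RM ≤ a + 1: "the level-j block is at least RM spacings of Λ_j thick, wall bond included".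
In print a + 1 would be a multiple of M (Ω_j^{(j)} a sum of big blocks); here a is free and only RM ≤ a + 1 (resp. the
sharp RML < (a+1)L + 1) enters.  (c) As in `…B6CoverTwoLevel` ∕ `…B6CoverRealizes` (D-b06.39 (i)) a wall bond (Λ_j-length
L^jη, joining x₀ = a of level j to x′₀ = 0 of level j + 1) is counted in B^j(Λ_j) with weight 1 in (2.46); the print is
silent on bonds crossing Σ_{j+1}.  The tower's wall sits ABOVE the level-j box in the x₀-direction (level j + 1 at larger
x₀), the two-level sibling put its coarse box below the fine face — an orientation convention; no identification of the
two models (nor with pv08's flat `twoScaleGraph`) is attempted.  (d) The walk-form constant: every contour from level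
< i to level > i has ≥ a + 2 bonds (enter level i through a wall at x₀ = 0, move x₀ from 0 to a, leave through the wall at
x₀ = a), i.e. `LevelGap (a + 1)` and not `LevelGap (a + 2)`; `levelGap_dist` then gives (a+1)·(|j−j′|−1)⁺ ≤ d, so (2.60)
∕ `LevelSep` hold for RM ≤ a + 1 and fail for RM > a + 2 (d(corner₀, corner₂) = a + 2 with exponent 1); the exact
`LevelSep` threshold lies in (a + 1, a + 2] and depends on k — not computed.  (e) Contours through a coarser level are
"cheaper" per unit Euclidean length ((2.46) weighs a Λ_{j+1}-bond like a Λ_j-bond), so the in-level comparison is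
d ≤ ‖Δx‖₁ (`dist_le_latL1Dist_of_lvl`), not an equality, exactly as (2.66) needs it.  (f) M = m ∈ ℕ, L ∈ ℕ with L ≥ 1
where the drawing is used (the metric route to the walk form needs monotone scales), η > 0 for (2.2) (η ≥ 0 for (len)),
R real of either sign in `twGeo_levelSep` ∕ `twGeo_ineq260` (only RM ≤ a + 1 enters), `Hyp21_22 := True` and the
localisation vocabulary trivial as on the sibling models.

HONEST SCOPE.  A MODELLING item — kernel bookkeeping at fixed lattice spacing on a finite (k+1)-level carrier: it
certifies that the tree's typed (2.2) (`Cond22` ∕ `SetSep22`), its walk form (`LevelGap`) and the R-dependent (2.60) ∕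
`LevelSep` are CONSISTENT WITH CONTENT — satisfiable on a realised multiscale geometry with ≥ 3 levels where each of them
excludes something, with the sharp constants — and that the abstract chains `levelGap_of_cond22`, `ineq260_of_levelGap`,
`ineq260_of_cond22`, `ineq260_of_setSep22` run on it by name.  It does NOT build the k-level cover {h_□} ∕ partition of
unity (2.36) on the tower, nor discharge the (2.61) ∕ (2.63) lattice-sum binders there, nor instantiate Propositions 2.3 ∕
2.7 on it (their analytic kernels stay hypotheses of `…B6Prop23Kernel` ∕ `…B6Prop27Kernel`; the two-level instantiation
is `…B6CoverRealizes`); it is NOT the shell geometry of (2.1)–(2.4) in a torus, NOT a continuum or ultraviolet-stability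
statement, and NOT progress on any Clay problem.
-/

namespace Literature.MathematicalPhysics.QuantumFieldTheory.Balaban1983to89.B6LevelTower

open Finset Real
open Literature.Probability.LatticeModels (Site zdGraph zdGraph_adj_iff latL1Dist)
open B4Sect5Torus (IsPseudoDist)
open B6RandomWalk (Ineq260 Triangle254)
open B6Ineq268 (LevelSep mx mx_nonneg levelSep_iff_ineq260)
open B6Geometry (ContourSystem dist246 Realizes Separates LevelGap triangle254_of_realizes hyps266_of_realizes
  ineq260_of_levelGap dist_self_of_realizes dist_nonneg_of_realizes dist_comm_of_realizes levelGap_dist_real)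
open B6LevelGapMetric (BondScale ZoneSep BondScale22 Cond22 levelGap_of_metric levelGap_of_cond22 ineq260_of_cond22
  ZonesOf SetSep SetSep22 setSep_iff_zoneSep cond22_of_setSep22 ineq260_of_setSep22)
open B6BoxCharts (IsBoxChart Atlas cboxClosed_Icc reachable_of_chart dist_le_latL1Dist_of_chart connected_of_atlas)
open B6CoverTwoLevel (zv zv_step clampBox zv_clampBox clampBox_zv zv_mem_Icc)

/-! ## §1  The level tower: carrier, wall offsets, positions, bonds -/

section Carrier

variable {d k a : ℕ}

/-- The sites of the LEVEL TOWER: a level index j ∈ {0, …, k} and a point of the box {0, …, a}^d of Λ_j-indices —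
𝔅 = ⋃_{j=0}^k Λ_j (2.45) with Λ_j ∩ B^j(Λ_j) one box per level. [cite: Balaban1984PropagatorsII, (2.45) p.231 + (2.3)–(2.4) p.224] -/
abbrev TW (d k a : ℕ) : Type := Fin (k + 1) × (Fin d → Fin (a + 1))

/-- The level j of a site (y ∈ Λ_j). [cite: Balaban1984PropagatorsII, (2.3) p.224] -/
def lvl (y : TW d k a) : ℕ := (y.1 : ℕ)

/-- Levels run from 0 to k. [cite: Balaban1984PropagatorsII, (2.45) p.231] -/
theorem lvl_le (y : TW d k a) : lvl y ≤ k := Nat.lt_succ_iff.mp y.1.isLt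

/-- The WALL OFFSET of level j in Λ₀-units: off₀ = 0, off_{j+1} = off_j + (a + 1)L^j — the level-j box occupies
x₀ ∈ [off_j, off_j + aL^j] and one Λ_j-bond (the wall) separates it from the level-(j+1) box. [folklore] -/
def off (L a : ℕ) : ℕ → ℤ
  | 0 => 0
  | z + 1 => off L a z + ((a : ℤ) + 1) * (L : ℤ) ^ z

/-- off₀ = 0. [folklore] -/
theorem off_zero (L a : ℕ) : off L a 0 = 0 := rfl

/-- off_{j+1} = off_j + (a + 1)L^j. [folklore] -/
theorem off_succ (L a z : ℕ) : off L a (z + 1) = off L a z + ((a : ℤ) + 1) * (L : ℤ) ^ z := rfl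

/-- The offsets increase. [folklore] -/
theorem off_le_succ (L a z : ℕ) : off L a z ≤ off L a (z + 1) := by
  rw [off_succ]
  have : (0 : ℤ) ≤ ((a : ℤ) + 1) * (L : ℤ) ^ z := by positivity
  linarith

/-- The offsets are monotone in the level. [folklore] -/
theorem off_mono (L a : ℕ) : Monotone (off L a) := monotone_nat_of_le_succ (off_le_succ L a)

/-- **The gap lemma**: the far face of level z plus one Λ_n-bond still lies below the near face of level n + 1:
off_z + aL^z + L^n ≤ off_{n+1} for z ≤ n. [folklore] -/
theorem off_gap (L a : ℕ) {z n : ℕ} (h : z ≤ n) :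
    off L a z + (a : ℤ) * (L : ℤ) ^ z + (L : ℤ) ^ n ≤ off L a (n + 1) := by
  induction n, h using Nat.le_induction with
  | base =>
    rw [off_succ]
    linarith [show ((a : ℤ) + 1) * (L : ℤ) ^ z = (a : ℤ) * (L : ℤ) ^ z + (L : ℤ) ^ z by ring]
  | succ n hzn ih =>
    rw [off_succ]
    have h0 : (0 : ℤ) ≤ (L : ℤ) ^ n := by positivity
    have h1 : (0 : ℤ) ≤ (a : ℤ) * (L : ℤ) ^ (n + 1) := by positivity
    linarith [show ((a : ℤ) + 1) * (L : ℤ) ^ (n + 1) = (a : ℤ) * (L : ℤ) ^ (n + 1) + (L : ℤ) ^ (n + 1) by ring]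

variable [NeZero d]

/-- The POSITION of a site in Λ₀-units (integer coordinates): the level-j point with index x sits at
(off_j + L^j x₀, L^j x₁, …, L^j x_{d−1}) — its own lattice has spacing L^j. [cite: Balaban1984PropagatorsII, (2.1)–(2.3) p.224] -/
def pos (L : ℕ) (y : TW d k a) (μ : Fin d) : ℤ :=
  (if μ = 0 then off L a (lvl y) else 0) + (L : ℤ) ^ lvl y * zv y.2 μ

/-- The BONDS: the Λ_j-bonds of each level-j box (nearest neighbours of the index lattice), and the WALL BONDS joining the
far-face point (a, Lv) of level j to the near-face point (0, v) of level j + 1 (a Λ_j-bond: the points of Λ_{j+1} on the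
wall sit on the sublattice LΛ_j) — *"a part of Γ contained in B^j(Λ_j) consists of bonds of the lattice Λ_j"*.
[cite: Balaban1984PropagatorsII, (2.46) p.231] -/
def bond (L : ℕ) (y y' : TW d k a) : Prop :=
  (y.1 = y'.1 ∧ (zdGraph d).Adj (zv y.2) (zv y'.2)) ∨
  (lvl y' = lvl y + 1 ∧ (y.2 0 : ℕ) = a ∧ (y'.2 0 : ℕ) = 0 ∧ ∀ μ, μ ≠ 0 → zv y.2 μ = (L : ℤ) * zv y'.2 μ)

/-- The bond graph of the tower (the admissible bonds). [cite: Balaban1984PropagatorsII, (2.46) p.231] -/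
def graph (L : ℕ) : SimpleGraph (TW d k a) := SimpleGraph.fromRel (bond L)

/-- **One bond moves exactly one coordinate of the position, by exactly L^{min(j, j′)}** (a Λ_j-bond of level j by L^j;
a wall bond between levels j, j + 1 by L^j, in the x₀-direction). [cite: Balaban1984PropagatorsII, (2.46) p.231] -/
theorem pos_step_of_bond (L : ℕ) {y y' : TW d k a} (h : bond L y y') :
    ∃ μ, (∀ ν, ν ≠ μ → pos L y ν = pos L y' ν) ∧ |pos L y μ - pos L y' μ| = (L : ℤ) ^ min (lvl y) (lvl y') := by
  rcases h with ⟨h1, h2⟩ | ⟨h1, h2, h3, h4⟩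
  · have hl : lvl y = lvl y' := congrArg Fin.val h1
    obtain ⟨μ, hμ, hstep⟩ := zv_step h2
    refine ⟨μ, fun ν hν => ?_, ?_⟩
    · simp only [pos, hl, hμ ν hν]
    · rw [← hl, min_self]
      simp only [pos, ← hl]
      rw [show (if μ = 0 then off L a (lvl y) else 0) + (L : ℤ) ^ lvl y * zv y.2 μ -
          ((if μ = 0 then off L a (lvl y) else 0) + (L : ℤ) ^ lvl y * zv y'.2 μ) =
          (L : ℤ) ^ lvl y * (zv y.2 μ - zv y'.2 μ) by ring, abs_mul, hstep, mul_one,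
        abs_of_nonneg (by positivity)]
  · refine ⟨0, fun ν hν => ?_, ?_⟩
    · simp only [pos, hν, if_false, zero_add, h1, h4 ν hν, pow_succ]
      ring
    · have hz : zv y.2 0 = (a : ℤ) := by simp [zv, h2]
      have hz' : zv y'.2 0 = 0 := by simp [zv, h3]
      rw [h1, min_eq_left (Nat.le_succ _)]
      simp only [pos, if_true, h1, off_succ, hz, hz']
      rw [show off L a (lvl y) + (L : ℤ) ^ lvl y * (a : ℤ) -
          (off L a (lvl y) + ((a : ℤ) + 1) * (L : ℤ) ^ lvl y + (L : ℤ) ^ (lvl y + 1) * 0) = -((L : ℤ) ^ lvl y) by ring,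
        abs_neg, abs_of_nonneg (by positivity)]

/-- The same for an edge of the bond graph (either orientation). [cite: Balaban1984PropagatorsII, (2.46) p.231] -/
theorem pos_step {L : ℕ} {y y' : TW d k a} (h : (graph L).Adj y y') :
    ∃ μ, (∀ ν, ν ≠ μ → pos L y ν = pos L y' ν) ∧ |pos L y μ - pos L y' μ| = (L : ℤ) ^ min (lvl y) (lvl y') := by
  rw [graph, SimpleGraph.fromRel_adj] at h
  rcases h.2 with h' | h'
  · exact pos_step_of_bond L h'
  · obtain ⟨μ, h1, h2⟩ := pos_step_of_bond L h'
    refine ⟨μ, fun ν hν => (h1 ν hν).symm, ?_⟩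
    rw [abs_sub_comm, min_comm]
    exact h2

/-- Along a bond the level changes by at most one. [cite: Balaban1984PropagatorsII, p.231] -/
theorem lvl_of_bond (L : ℕ) {y y' : TW d k a} (h : bond L y y') : lvl y' = lvl y ∨ lvl y' = lvl y + 1 := by
  rcases h with ⟨h1, -⟩ | ⟨h1, -⟩
  · exact Or.inl (congrArg Fin.val h1).symm
  · exact Or.inr h1

/-- **Σ_{j+1} separates B^j(Λ_j) from B^{j+1}(Λ_{j+1})**: the levels of the two ends of an admissible bond differ by at
most one (*"The surface Σ_j separates the sets B^j(Λ_j) and B^{j−1}(Λ_{j−1})"*). [cite: Balaban1984PropagatorsII, p.231] -/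
theorem graph_separates (L : ℕ) : Separates (graph L : SimpleGraph (TW d k a)) lvl := by
  intro u v h
  rw [graph, SimpleGraph.fromRel_adj] at h
  rcases h.2 with h' | h'
  · rcases lvl_of_bond L h' with h1 | h1 <;> omega
  · rcases lvl_of_bond L h' with h1 | h1 <;> omega

/-- x₀ of a level-j point is at most off_j + aL^j (the far face). [folklore] -/
theorem pos_zero_le (L : ℕ) (y : TW d k a) : pos L y 0 ≤ off L a (lvl y) + (a : ℤ) * (L : ℤ) ^ lvl y := by
  simp only [pos, if_true]
  have h1 : zv y.2 0 ≤ (a : ℤ) := (zv_mem_Icc y.2).2 0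
  have h2 : (0 : ℤ) ≤ (L : ℤ) ^ lvl y := by positivity
  nlinarith

/-- x₀ of a level-j point is at least off_j (the near face). [folklore] -/
theorem off_le_pos_zero (L : ℕ) (y : TW d k a) : off L a (lvl y) ≤ pos L y 0 := by
  simp only [pos, if_true]
  have h1 : (0 : ℤ) ≤ zv y.2 0 := (zv_mem_Icc y.2).1 0
  have h2 : (0 : ℤ) ≤ (L : ℤ) ^ lvl y := by positivity
  nlinarith

/-- **The x₀-gap across a full level**: a point of level ≤ n and a point of level ≥ n + 2 are at least
(a + 1)L^{n+1} + L^n apart in the x₀-direction (the whole level-(n+1) block plus the wall bond below it).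
[cite: Balaban1984PropagatorsII, (2.2) p.224 + (2.57) p.233] -/
theorem pos_zero_gap (L : ℕ) {u x : TW d k a} {n : ℕ} (hu : lvl u ≤ n) (hx : n + 2 ≤ lvl x) :
    ((a : ℤ) + 1) * (L : ℤ) ^ (n + 1) + (L : ℤ) ^ n ≤ pos L x 0 - pos L u 0 := by
  have h1 := pos_zero_le L u
  have h2 := off_gap L a hu
  have h3 := off_le_pos_zero L x
  have h4 : off L a (n + 2) ≤ off L a (lvl x) := off_mono L a hx
  have h5 : off L a (n + 2) = off L a (n + 1) + ((a : ℤ) + 1) * (L : ℤ) ^ (n + 1) := off_succ L a (n + 1)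
  linarith

/-- The FAR CORNER index (a, 0, …, 0) of a level box (the end of a wall bond). [folklore] -/
def cornerA (d a : ℕ) [NeZero d] : Fin d → Fin (a + 1) := fun μ => if μ = 0 then Fin.last a else 0

/-- The corner wall bond: (j, (a, 0, …, 0)) ∼ (j + 1, (0, …, 0)). [cite: Balaban1984PropagatorsII, (2.46) p.231] -/
theorem adj_wall (L : ℕ) (z z' : Fin (k + 1)) (h : (z' : ℕ) = z + 1) :
    (graph L : SimpleGraph (TW d k a)).Adj (z, cornerA d a) (z', 0) := by
  rw [graph, SimpleGraph.fromRel_adj]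
  refine ⟨fun heq => ?_, Or.inl (Or.inr ⟨h, by simp [cornerA], by simp, fun μ hμ => by simp [zv, cornerA, hμ]⟩)⟩
  have := congrArg (fun p : TW d k a => (p.1 : ℕ)) heq
  simp only at this
  omega

end Carrier

/-! ## §2  The atlas of level charts, connectivity, the distance (2.46) of the tower -/

section AtlasSec

variable {d k a : ℕ} [NeZero d]

/-- Each level box is a box chart of the bond graph (all its Λ_j-bonds are admissible). [cite: Balaban1984PropagatorsII, p.231] -/
theorem chart_lvl (L : ℕ) (z : Fin (k + 1)) :
    IsBoxChart (graph L : SimpleGraph (TW d k a)) (Set.Icc 0 (fun _ => (a : ℤ))) (fun v => (z, clampBox a v)) := by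
  refine ⟨cboxClosed_Icc _ _, fun v v' hv hv' h => ?_⟩
  rw [graph, SimpleGraph.fromRel_adj]
  refine ⟨fun heq => h.ne ?_, Or.inl (Or.inl ⟨rfl, ?_⟩)⟩
  · have := (Prod.mk.inj heq).2
    rw [← zv_clampBox hv, ← zv_clampBox hv', this]
  · show (zdGraph d).Adj (zv (clampBox a v)) (zv (clampBox a v'))
    rwa [zv_clampBox hv, zv_clampBox hv']

/-- **The atlas of the tower**: one box chart per level. [cite: Balaban1984PropagatorsII, (2.4) p.224 + p.231] -/
noncomputable def twAtlas (L : ℕ) : Atlas (graph L : SimpleGraph (TW d k a)) d (Fin (k + 1)) where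
  box _ := Set.Icc 0 (fun _ => (a : ℤ))
  φ z := fun v => (z, clampBox a v)
  chart z := chart_lvl L z

/-- The level charts cover the tower ((2.4) *"T = ⋃_{j=0}^k B^j(Λ_j)"*). [cite: Balaban1984PropagatorsII, (2.4) p.224] -/
theorem twAtlas_covers (L : ℕ) : (twAtlas (d := d) (k := k) (a := a) L).Covers := by
  intro y
  refine ⟨y.1, zv y.2, zv_mem_Icc y.2, ?_⟩
  show (y.1, clampBox a (zv y.2)) = y
  rw [clampBox_zv]

/-- Consecutive level charts are linked (by the corner wall bond). [cite: Balaban1984PropagatorsII, (2.46) p.231] -/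
theorem twAtlas_linked (L : ℕ) {z z' : Fin (k + 1)} (h : (z' : ℕ) = z + 1) :
    (twAtlas (d := d) (k := k) (a := a) L).Linked z z' := by
  refine ⟨zv (cornerA d a), zv (0 : Fin d → Fin (a + 1)), zv_mem_Icc _, zv_mem_Icc _, Or.inr ?_⟩
  show (graph L).Adj (z, clampBox a (zv (cornerA d a))) (z', clampBox a (zv (0 : Fin d → Fin (a + 1))))
  rw [clampBox_zv, clampBox_zv]
  exact adj_wall L z z' h

/-- Consecutive levels are adjacent in the nerve. [folklore] -/
theorem twAtlas_nerve_adj (L : ℕ) {z z' : Fin (k + 1)} (h : (z' : ℕ) = z + 1) :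
    (twAtlas (d := d) (k := k) (a := a) L).nerve.Adj z z' := by
  rw [B6BoxCharts.Atlas.nerve, SimpleGraph.fromRel_adj]
  refine ⟨fun he => ?_, Or.inl (twAtlas_linked L h)⟩
  have := congrArg Fin.val he
  omega

/-- Every level is reachable from level 0 in the nerve (the nerve is a path). [folklore] -/
theorem twAtlas_nerve_reachable (L : ℕ) (z : Fin (k + 1)) :
    (twAtlas (d := d) (k := k) (a := a) L).nerve.Reachable ⟨0, Nat.succ_pos k⟩ z := by
  obtain ⟨n, hn⟩ := z
  induction n with
  | zero => exact SimpleGraph.Reachable.refl _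
  | succ n ih =>
    have hn' : n < k + 1 := by omega
    exact (ih hn').trans (twAtlas_nerve_adj L (z := ⟨n, hn'⟩) (z' := ⟨n + 1, hn⟩) rfl).reachable

/-- The nerve of the atlas is preconnected. [folklore] -/
theorem twAtlas_nerve_preconnected (L : ℕ) : (twAtlas (d := d) (k := k) (a := a) L).nerve.Preconnected :=
  fun z z' => (twAtlas_nerve_reachable L z).symm.trans (twAtlas_nerve_reachable L z')

/-- **The bond graph of the tower is connected** (staircases inside each level + the wall bonds; from block data by
`…B6BoxCharts.connected_of_atlas`), so the infimum (2.46) is attained: *"Of course the infimum is attained at some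
contour Γ_{y,y′}"*. [cite: Balaban1984PropagatorsII, p.231] -/
theorem graph_connected (L : ℕ) : (graph L : SimpleGraph (TW d k a)).Connected :=
  connected_of_atlas (twAtlas_covers L) (twAtlas_nerve_preconnected L)

/-- d(y, y′) := the number of bonds of a shortest admissible contour of the tower — (2.46) with every Λ_j-bond of
B^j(Λ_j) counting (L^jη)^{−1}·L^jη = 1. [cite: Balaban1984PropagatorsII, (2.46) p.231] -/
noncomputable def tdist (L : ℕ) (y y' : TW d k a) : ℝ := ((graph L).dist y y' : ℝ)

/-- d(y, y) = 0. [folklore] -/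
theorem tdist_self (L : ℕ) (y : TW d k a) : tdist L y y = 0 := by
  simp [tdist]

/-- d is symmetric. [folklore] -/
theorem tdist_comm (L : ℕ) (y y' : TW d k a) : tdist L y y' = tdist L y' y := by
  unfold tdist
  rw [SimpleGraph.dist_comm]

/-- d ≥ 0. [folklore] -/
theorem tdist_nonneg (L : ℕ) (y y' : TW d k a) : 0 ≤ tdist L y y' := Nat.cast_nonneg _

/-- (2.54) on the tower. [cite: Balaban1984PropagatorsII, (2.54) p.233] -/
theorem tdist_triangle (L : ℕ) (y y' y'' : TW d k a) : tdist L y y'' ≤ tdist L y y' + tdist L y' y'' := by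
  unfold tdist
  exact_mod_cast (graph_connected L).dist_triangle

/-- d is a pseudo-distance (the binder `hρ`). [folklore] -/
theorem isPseudoDist_tdist (L : ℕ) : IsPseudoDist (tdist L : TW d k a → TW d k a → ℝ) :=
  ⟨tdist_comm L, tdist_self L, tdist_triangle L⟩

/-- **In-level comparison** (the in-box case of (2.66)): two points of one level are at distance ≤ the ℓ¹ distance of
their Λ_j-indices (a staircase inside the box; contours through other levels may be shorter).
[cite: Balaban1984PropagatorsII, (2.46) p.231 + (2.66) p.234] -/
theorem dist_le_latL1Dist_of_lvl (L : ℕ) (z : Fin (k + 1)) (x x' : Fin d → Fin (a + 1)) :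
    (graph L : SimpleGraph (TW d k a)).dist (z, x) (z, x') ≤ latL1Dist (zv x) (zv x') := by
  have := dist_le_latL1Dist_of_chart (chart_lvl (d := d) (k := k) (a := a) L z) (zv_mem_Icc x) (zv_mem_Icc x')
  rwa [clampBox_zv, clampBox_zv] at this

/-- The near corner and the far corner of a level box are a Λ_j-indices apart. [folklore] -/
theorem latL1Dist_zero_cornerA : latL1Dist (zv (0 : Fin d → Fin (a + 1))) (zv (cornerA d a)) = a := by
  unfold latL1Dist
  have key : ∀ μ : Fin d, (zv (0 : Fin d → Fin (a + 1)) μ - zv (cornerA d a) μ).natAbs = if μ = 0 then a else 0 := by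
    intro μ
    by_cases hμ : μ = 0
    · subst hμ
      simp [zv, cornerA]
    · simp [zv, cornerA, hμ]
  rw [Finset.sum_congr rfl (fun μ _ => key μ), Finset.sum_ite_eq']
  simp

/-- Across one level: the far corner of level j and the near corner of level j + 2 are joined by the contour wall –
a bonds along x₀ in level j + 1 – wall, of a + 2 bonds. [cite: Balaban1984PropagatorsII, (2.46)–(2.47) p.231] -/
theorem dist_wall2_le (L : ℕ) (z z' z'' : Fin (k + 1)) (h' : (z' : ℕ) = z + 1) (h'' : (z'' : ℕ) = z' + 1) :
    (graph L : SimpleGraph (TW d k a)).dist (z, cornerA d a) (z'', 0) ≤ a + 2 := by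
  have hc := graph_connected (d := d) (k := k) (a := a) L
  have h1 : (graph L : SimpleGraph (TW d k a)).dist (z, cornerA d a) (z', 0) = 1 :=
    SimpleGraph.dist_eq_one_iff_adj.mpr (adj_wall L z z' h')
  have h2 : (graph L : SimpleGraph (TW d k a)).dist (z', 0) (z', cornerA d a) ≤ a := by
    have := dist_le_latL1Dist_of_lvl (d := d) (k := k) (a := a) L z' 0 (cornerA d a)
    rwa [latL1Dist_zero_cornerA] at this
  have h3 : (graph L : SimpleGraph (TW d k a)).dist (z', cornerA d a) (z'', 0) = 1 :=
    SimpleGraph.dist_eq_one_iff_adj.mpr (adj_wall L z' z'' h'')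
  calc (graph L : SimpleGraph (TW d k a)).dist (z, cornerA d a) (z'', 0)
      ≤ (graph L).dist (z, cornerA d a) (z', 0) + (graph L).dist (z', 0) (z'', 0) := hc.dist_triangle
    _ ≤ (graph L).dist (z, cornerA d a) (z', 0) +
        ((graph L).dist (z', 0) (z', cornerA d a) + (graph L).dist (z', cornerA d a) (z'', 0)) :=
          Nat.add_le_add_left hc.dist_triangle _
    _ ≤ 1 + (a + 1) := by rw [h1, h3]; omega
    _ = a + 2 := by ring

end AtlasSec

/-! ## §3  The drawing in ℝ^d: (len) with equality, (2.2) with content both ways, the sharp walk form -/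

section Drawing

variable {d k a : ℕ} [NeZero d]

/-- The tower DRAWN IN ℝ^d (sup metric) at unit η: y ↦ η·pos(y) — the level-j box on the lattice L^jη·ℤ^d of Λ_j,
shifted by off_jη in the x₀-direction. [cite: Balaban1984PropagatorsII, (2.1)–(2.3) p.224] -/
noncomputable def tposR (L : ℕ) (η : ℝ) (y : TW d k a) : Fin d → ℝ := fun μ => η * ((pos L y μ : ℤ) : ℝ)

/-- **(len) with EQUALITY**: an admissible bond between levels j, j′ has extent exactly L^{min(j,j′)}η in the drawing
(η ≥ 0) — the weight (L^jη)^{−1}|bond| = 1 of (2.46). [cite: Balaban1984PropagatorsII, (2.46) p.231 + (2.1) p.224] -/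
theorem dist_tposR_eq {L : ℕ} {η : ℝ} (hη : 0 ≤ η) {y y' : TW d k a} (h : (graph L).Adj y y') :
    dist (tposR L η y) (tposR L η y') = (L : ℝ) ^ min (lvl y) (lvl y') * η := by
  obtain ⟨μ, h1, h2⟩ := pos_step h
  have hcoord : ∀ ν, dist (tposR L η y ν) (tposR L η y' ν) = if ν = μ then (L : ℝ) ^ min (lvl y) (lvl y') * η else 0 := by
    intro ν
    rw [Real.dist_eq, tposR, tposR, ← mul_sub, abs_mul, abs_of_nonneg hη, ← Int.cast_sub, ← Int.cast_abs]
    by_cases hν : ν = μ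
    · subst hν
      rw [if_pos rfl, h2]
      push_cast
      ring
    · rw [if_neg hν, h1 ν hν, sub_self, abs_zero, Int.cast_zero, mul_zero]
  refine le_antisymm ((dist_pi_le_iff (by positivity)).2 fun ν => ?_) ?_
  · rw [hcoord ν]
    split_ifs
    · exact le_rfl
    · positivity
  · have := dist_le_pi_dist (tposR L η y) (tposR L η y') μ
    rwa [hcoord μ, if_pos rfl] at this

/-- (len) `…B6LevelGapMetric.BondScale` for the drawing: every admissible bond {u, v} has extent ≤ L^{min(lvl u, lvl v)}η.
[cite: Balaban1984PropagatorsII, p.231] -/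
theorem bondScale_tposR {L : ℕ} {η : ℝ} (hη : 0 ≤ η) :
    BondScale (graph L : SimpleGraph (TW d k a)) lvl (tposR L η) (fun j => (L : ℝ) ^ j * η) :=
  fun _ _ h => (dist_tposR_eq hη h).le

/-- **The distance across a full level in the drawing**: a point of level ≤ n and a point of level ≥ n + 2 are at least
η((a + 1)L^{n+1} + L^n) apart — dist(Ω^c_{n+1}, Ω_{n+2}) on lattice points. [cite: Balaban1984PropagatorsII, (2.2) p.224 + (2.57) p.233] -/
theorem dist_tposR_ge {L : ℕ} {η : ℝ} (hη : 0 ≤ η) {u x : TW d k a} {n : ℕ} (hu : lvl u ≤ n) (hx : n + 2 ≤ lvl x) :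
    η * (((a : ℝ) + 1) * (L : ℝ) ^ (n + 1) + (L : ℝ) ^ n) ≤ dist (tposR L η u) (tposR L η x) := by
  have hgap : ((a : ℝ) + 1) * (L : ℝ) ^ (n + 1) + (L : ℝ) ^ n ≤ ((pos L x 0 : ℤ) : ℝ) - ((pos L u 0 : ℤ) : ℝ) := by
    have := pos_zero_gap L hu hx
    exact_mod_cast this
  have h0 : dist (tposR L η u 0) (tposR L η x 0) ≤ dist (tposR L η u) (tposR L η x) := dist_le_pi_dist _ _ 0
  rw [Real.dist_eq, tposR, tposR, abs_sub_comm, ← mul_sub, abs_mul, abs_of_nonneg hη] at h0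
  calc η * (((a : ℝ) + 1) * (L : ℝ) ^ (n + 1) + (L : ℝ) ^ n)
      ≤ η * |((pos L x 0 : ℤ) : ℝ) - ((pos L u 0 : ℤ) : ℝ)| :=
        mul_le_mul_of_nonneg_left (hgap.trans (le_abs_self _)) hη
    _ ≤ dist (tposR L η u) (tposR L η x) := h0

/-- **Condition (2.2) on the tower, with content**: for L ≥ 1, η > 0 and any threshold T with T·L < (a + 1)L + 1 (e.g.
T ≤ a + 1), every point below level i and every point above level i are MORE than T·L^iη apart —
`…B6LevelGapMetric.ZoneSep` (= (2.2) *"(L^jη)^{−1} dist(Ω_j^c, Ω_{j+1}) > RM"* on lattice points, T = RM).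
[cite: Balaban1984PropagatorsII, (2.2) p.224] -/
theorem zoneSep_tposR {L : ℕ} (hL : 1 ≤ L) {η : ℝ} (hη : 0 < η) {T : ℝ} (hT : T * L < ((a : ℝ) + 1) * L + 1) :
    ZoneSep (lvl : TW d k a → ℕ) (tposR L η) (fun j => (L : ℝ) ^ j * η) T := by
  intro i u x hu hx
  obtain ⟨n, rfl⟩ : ∃ n, i = n + 1 := Nat.exists_eq_succ_of_ne_zero (by omega)
  have hun : lvl u ≤ n := by omega
  have hxn : n + 2 ≤ lvl x := by omega
  have hLn : (0 : ℝ) < (L : ℝ) ^ n * η := by positivity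
  have hb := dist_tposR_ge hη.le hun hxn (L := L)
  calc T * ((L : ℝ) ^ (n + 1) * η) = T * (L : ℝ) * ((L : ℝ) ^ n * η) := by ring
    _ < (((a : ℝ) + 1) * L + 1) * ((L : ℝ) ^ n * η) := mul_lt_mul_of_pos_right hT hLn
    _ = η * (((a : ℝ) + 1) * (L : ℝ) ^ (n + 1) + (L : ℝ) ^ n) := by ring
    _ ≤ dist (tposR L η u) (tposR L η x) := hb

/-- The witness pair for the failure of (2.2): the far corner of level 0 and the near corner of level 2 are at most
((a + 1)L + 1)η apart in the drawing (η ≥ 0; with `dist_tposR_ge` this is an equality — only the upper bound is used).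
[cite: Balaban1984PropagatorsII, (2.2) p.224] -/
theorem dist_tposR_wall2_le (hk : 2 ≤ k) {L : ℕ} {η : ℝ} (hη : 0 ≤ η) :
    dist (tposR L η ((⟨0, Nat.succ_pos k⟩, cornerA d a) : TW d k a)) (tposR L η ((⟨2, by omega⟩, 0) : TW d k a)) ≤
      η * (((a : ℝ) + 1) * L + 1) := by
  refine (dist_pi_le_iff (by positivity)).2 fun μ => ?_
  rw [Real.dist_eq, tposR, tposR, ← mul_sub, abs_mul, abs_of_nonneg hη]
  refine mul_le_mul_of_nonneg_left ?_ hη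
  by_cases hμ : μ = 0
  · subst hμ
    have h0 : pos L ((⟨0, Nat.succ_pos k⟩, cornerA d a) : TW d k a) 0 = (a : ℤ) := by
      simp [pos, lvl, off_zero, zv, cornerA]
    have h2 : pos L ((⟨2, by omega⟩, 0) : TW d k a) 0 = ((a : ℤ) + 1) + ((a : ℤ) + 1) * (L : ℤ) := by
      simp [pos, lvl, off_succ, off_zero, zv]
    rw [h0, h2, ← Int.cast_sub, ← Int.cast_abs,
      show (a : ℤ) - ((a : ℤ) + 1 + ((a : ℤ) + 1) * (L : ℤ)) = -(((a : ℤ) + 1) * (L : ℤ) + 1) by ring, abs_neg,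
      abs_of_nonneg (by positivity)]
    push_cast
    exact le_rfl
  · have h0 : pos L ((⟨0, Nat.succ_pos k⟩, cornerA d a) : TW d k a) μ = 0 := by
      simp [pos, lvl, zv, cornerA, hμ]
    have h2 : pos L ((⟨2, by omega⟩, 0) : TW d k a) μ = 0 := by
      simp [pos, lvl, zv, hμ]
    rw [h0, h2, sub_self, abs_zero]
    positivity

/-- **(2.2) FAILS on the tower when (a + 1)L + 1 ≤ T·L** (three levels needed, η > 0): the hypothesis of `zoneSep_tposR`
is load-bearing. [cite: Balaban1984PropagatorsII, (2.2) p.224] -/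
theorem not_zoneSep_tposR (hk : 2 ≤ k) {L : ℕ} {η : ℝ} (hη : 0 < η) {T : ℝ} (hT : ((a : ℝ) + 1) * L + 1 ≤ T * L) :
    ¬ ZoneSep (lvl : TW d k a → ℕ) (tposR L η) (fun j => (L : ℝ) ^ j * η) T := by
  intro h
  have h1 := h (i := 1) (u := ((⟨0, Nat.succ_pos k⟩, cornerA d a) : TW d k a)) (x := (⟨2, by omega⟩, 0))
    (by simp [lvl]) (by simp [lvl])
  have h2 := dist_tposR_wall2_le (d := d) (a := a) hk hη.le (L := L)
  have h3 : η * (((a : ℝ) + 1) * L + 1) ≤ T * ((L : ℝ) ^ 1 * η) := by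
    rw [pow_one, show T * ((L : ℝ) * η) = η * (T * L) by ring]
    exact mul_le_mul_of_nonneg_left hT hη.le
  linarith

/-- **(2.2) on the tower ⟺ T·L < (a + 1)L + 1** (k ≥ 2, L ≥ 1, η > 0). [cite: Balaban1984PropagatorsII, (2.2) p.224] -/
theorem zoneSep_tposR_iff (hk : 2 ≤ k) {L : ℕ} (hL : 1 ≤ L) {η : ℝ} (hη : 0 < η) {T : ℝ} :
    ZoneSep (lvl : TW d k a → ℕ) (tposR L η) (fun j => (L : ℝ) ^ j * η) T ↔ T * L < ((a : ℝ) + 1) * L + 1 := by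
  refine ⟨fun h => ?_, zoneSep_tposR hL hη⟩
  by_contra hc
  exact not_zoneSep_tposR hk hη (not_lt.mp hc) h

/-- **The walk form of (2.2) on the tower, sharp constant**: every admissible contour from a point of level < i to a
point of level > i has at least a + 2 bonds — `…B6Geometry.LevelGap … (a + 1)` ((2.57) *"(L^{j_{l,l+1}}η)^{−1}
|y′_l − y_{l+1}| > RM"* ⇒ more than RM bonds, here with a + 1 in place of RM), by the metric route
`…B6LevelGapMetric.levelGap_of_metric` on the drawing at η = 1 (L ≥ 1). [cite: Balaban1984PropagatorsII, (2.57) p.233 + (2.2) p.224] -/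
theorem graph_levelGap {L : ℕ} (hL : 1 ≤ L) : LevelGap (graph L : SimpleGraph (TW d k a)) lvl (a + 1) := by
  have hL' : (1 : ℝ) ≤ (L : ℝ) := by exact_mod_cast hL
  refine levelGap_of_metric (pos := tposR L 1) (ℓ := fun j => (L : ℝ) ^ j * 1) (T := (a : ℝ) + 1)
    (fun i j hij => ?_) (bondScale_tposR zero_le_one) (zoneSep_tposR hL one_pos ?_) ?_
  · simpa using pow_le_pow_right₀ hL' hij
  · linarith
  · push_cast
    exact le_rfl

/-- **The distance across one level is exactly a + 2** (L ≥ 1): the corner contour of `dist_wall2_le` is shortest.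
[cite: Balaban1984PropagatorsII, (2.46)–(2.48) pp.231–232 + (2.57) p.233] -/
theorem dist_wall2_eq {L : ℕ} (hL : 1 ≤ L) (z z' z'' : Fin (k + 1)) (h' : (z' : ℕ) = z + 1) (h'' : (z'' : ℕ) = z' + 1) :
    (graph L : SimpleGraph (TW d k a)).dist (z, cornerA d a) (z'', 0) = a + 2 := by
  refine le_antisymm (dist_wall2_le L z z' z'' h' h'') ?_
  obtain ⟨p, hp⟩ := ((graph_connected (d := d) (k := k) (a := a) L).preconnected (z, cornerA d a) (z'', 0)).exists_walk_length_eq_dist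
  rw [← hp]
  exact graph_levelGap hL (i := (z : ℕ) + 1) (by simp [lvl]) (by simp [lvl]; omega) p

/-- **The walk form fails with a + 2** (three levels needed): the corner contour across level 1 has a + 2 < a + 3 bonds.
[cite: Balaban1984PropagatorsII, (2.57) p.233] -/
theorem graph_not_levelGap (hk : 2 ≤ k) (L : ℕ) : ¬ LevelGap (graph L : SimpleGraph (TW d k a)) lvl (a + 2) := by
  intro h
  obtain ⟨p, hp⟩ := ((graph_connected (d := d) (k := k) (a := a) L).preconnected
    ((⟨0, Nat.succ_pos k⟩, cornerA d a) : TW d k a) (⟨2, by omega⟩, 0)).exists_walk_length_eq_dist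
  have h1 := h (i := 1) (by simp [lvl]) (by simp [lvl]) p
  have h2 := dist_wall2_le (d := d) (k := k) (a := a) L ⟨0, Nat.succ_pos k⟩ ⟨1, by omega⟩ ⟨2, by omega⟩ rfl rfl
  omega

/-- **The level-distance bound** ((2.47)–(2.48) + (2.57) ⇒ the exponent of (2.60)): (a + 1)·max{|j − j′| − 1, 0} ≤
d(y, y′) for y ∈ Λ_j, y′ ∈ Λ_{j′} (L ≥ 1). [cite: Balaban1984PropagatorsII, (2.48) p.232 + (2.57) p.233 + (2.60) p.234] -/
theorem dist_ge_levels {L : ℕ} (hL : 1 ≤ L) (y y' : TW d k a) :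
    ((a : ℝ) + 1) * max (|(lvl y : ℝ) - lvl y'| - 1) 0 ≤ tdist L y y' := by
  have := levelGap_dist_real (graph_connected L) (graph_levelGap (d := d) (k := k) (a := a) hL) y y'
  unfold tdist
  push_cast at this
  exact this

end Drawing

/-! ## §4  The domains Ω_j of (2.1)–(2.4) on the tower -/

section Domains

variable {d k a : ℕ}

/-- Ω_j := the sites of level ≥ j (Ω_j = ⋃_{j′ ≥ j} B^{j′}(Λ_{j′}) on lattice points; Ω₀ = T). [cite: Balaban1984PropagatorsII, (2.1)–(2.4) p.224] -/
def dom (j : ℕ) : Set (TW d k a) := {y | j ≤ lvl y}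

/-- The (2.3)–(2.4) dictionary of `…B6LevelGapMetric.ZonesOf`: y ∈ Ω_j ↔ j ≤ level of y. [cite: Balaban1984PropagatorsII, (2.3)–(2.4) p.224] -/
theorem zonesOf_dom : ZonesOf (dom : ℕ → Set (TW d k a)) lvl := fun _ _ => Iff.rfl

/-- (2.1) *"Ω₁ ⊃ Ω₂ ⊃ … ⊃ Ω_k"*: the domains are nested. [cite: Balaban1984PropagatorsII, (2.1) p.224] -/
theorem dom_antitone : Antitone (dom : ℕ → Set (TW d k a)) := (zonesOf_dom (d := d) (k := k) (a := a)).antitone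

/-- (2.4) *"T = ⋃_{j=0}^k B^j(Λ_j)"*: Ω₀ is everything. [cite: Balaban1984PropagatorsII, (2.4) p.224] -/
theorem dom_zero : (dom 0 : Set (TW d k a)) = Set.univ := by
  ext y
  simp [dom]

/-- There is no level above k: Ω_{k+1} = ∅. [cite: Balaban1984PropagatorsII, (2.45) p.231] -/
theorem dom_succ_top : (dom (k + 1) : Set (TW d k a)) = ∅ := by
  ext y
  simp only [dom, Set.mem_setOf_eq, Set.mem_empty_iff_false, iff_false, not_le]
  exact Nat.lt_succ_of_le (lvl_le y)

/-- (2.3) *"Λ_j = Ω_j^{(j)}∖Ω^{(j)}_{j+1}"*: the level-j sites are Ω_j ∖ Ω_{j+1}. [cite: Balaban1984PropagatorsII, (2.3) p.224] -/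
theorem dom_diff_succ (j : ℕ) : (dom j \ dom (j + 1) : Set (TW d k a)) = {y | lvl y = j} := by
  ext y
  simp only [dom, Set.mem_sdiff, Set.mem_setOf_eq, not_le]
  omega

variable {X : Type*} [PseudoMetricSpace X]

/-- (2.2) at SET level (`…B6LevelGapMetric.SetSep`: dist(Ω_j^c, Ω_{j+1}) > T·ℓ_j pointwise) IS (2.2) on points for the
tower's domains. [cite: Balaban1984PropagatorsII, (2.2)–(2.4) p.224] -/
theorem setSep_dom_iff (p : TW d k a → X) (ℓ : ℕ → ℝ) (T : ℝ) :
    SetSep (dom : ℕ → Set (TW d k a)) p ℓ T ↔ ZoneSep lvl p ℓ T :=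
  setSep_iff_zoneSep zonesOf_dom

end Domains

/-! ## §5  The geometry `twGeo`, the contour system `twCS`, and the metric binders with content -/

section Geo

variable (d : ℕ) [NeZero d] (k a m L : ℕ) (η R : ℝ)

/-- **The coordinatised (k+1)-level geometry**: 𝔅 = the level tower (levels 0, …, k, one box of (a+1)^d Λ_j-points per
level, scale ratio L ∈ ℕ); d = the number of bonds of a shortest admissible contour ((2.46), every bond weighing 1);
M = m the size of big blocks, R, η free; the localisation vocabulary trivial (not used here).
[cite: Balaban1984PropagatorsII, (2.1)–(2.4) p.224 + (2.45)–(2.46) p.231] -/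
@[reducible] noncomputable def twGeo : B6.Geometry where
  Site := TW d k a
  fin := inferInstance
  scale := lvl
  dist := tdist L
  k := k
  eta := η
  L := L
  R := R
  M := m
  Hyp21_22 := True
  Loc := PUnit
  suppIn := fun _ _ => True
  supNorm := fun _ => 0
  l2Norm := fun _ => 0
  holder := fun _ _ => 0
  Cut := PUnit
  cutIn := fun _ _ => True
  cutH := fun _ _ => 0
  cutSup := fun _ => 0

/-- **The tower as a contour system of `…B6Geometry`**: lattice points = the sites, admissible bonds = `graph`, zones =
levels. [cite: Balaban1984PropagatorsII, (2.45)–(2.46) p.231] -/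
noncomputable def twCS : ContourSystem (twGeo d k a m L η R) where
  Pt := TW d k a
  bond := graph L
  ι := fun y => y
  zone := lvl
  zone_ι := fun _ => rfl

/-- The zone of a site is its level. [folklore] -/
theorem twCS_zone (y : TW d k a) : (twCS d k a m L η R).zone y = lvl y := rfl

/-- **`twGeo` REALISES (2.46)** — by construction. [cite: Balaban1984PropagatorsII, (2.46) p.231] -/
theorem twGeo_realizes : Realizes (twGeo d k a m L η R) (twCS d k a m L η R) := fun _ _ => rfl

/-- Admissible contours exist. [cite: Balaban1984PropagatorsII, p.231] -/
theorem twCS_connected : (twCS d k a m L η R).bond.Connected := graph_connected L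

/-- **Σ_j separates** on the tower. [cite: Balaban1984PropagatorsII, p.231] -/
theorem twCS_separates : Separates (twCS d k a m L η R).bond (twCS d k a m L η R).zone := graph_separates L

/-- **(len) on the tower** (`…B6LevelGapMetric.BondScale22`), η ≥ 0. [cite: Balaban1984PropagatorsII, p.231 + (2.1) p.224] -/
theorem twCS_bondScale22 (hη : 0 ≤ η) : BondScale22 (twCS d k a m L η R) (tposR L η) := bondScale_tposR hη

/-- **(2.2) HOLDS on the tower** (`…B6LevelGapMetric.Cond22` = *"(L^jη)^{−1} dist(Ω_j^c, Ω_{j+1}) > RM"* on lattice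
points) whenever RM·L < (a + 1)L + 1, for L ≥ 1, η > 0. [cite: Balaban1984PropagatorsII, (2.2) p.224] -/
theorem twCS_cond22 (hL : 1 ≤ L) (hη : 0 < η) (hRM : R * m * L < ((a : ℝ) + 1) * L + 1) :
    Cond22 (twCS d k a m L η R) (tposR L η) := zoneSep_tposR hL hη hRM

/-- (2.2) on the tower for RM ≤ a + 1 ("the level-j block is at least RM Λ_j-spacings thick"). [cite: Balaban1984PropagatorsII, (2.2) p.224] -/
theorem twCS_cond22_of_le (hL : 1 ≤ L) (hη : 0 < η) (hRM : R * m ≤ (a : ℝ) + 1) :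
    Cond22 (twCS d k a m L η R) (tposR L η) := by
  refine twCS_cond22 d k a m L η R hL hη (lt_of_le_of_lt ?_ (lt_add_one _))
  exact mul_le_mul_of_nonneg_right hRM (Nat.cast_nonneg L)

/-- **(2.2) FAILS on the tower when (a + 1)L + 1 ≤ RM·L** (k ≥ 2, η > 0). [cite: Balaban1984PropagatorsII, (2.2) p.224] -/
theorem twCS_not_cond22 (hk : 2 ≤ k) (hη : 0 < η) (hRM : ((a : ℝ) + 1) * L + 1 ≤ R * m * L) :
    ¬ Cond22 (twCS d k a m L η R) (tposR L η) := not_zoneSep_tposR hk hη hRM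

/-- **(2.2) on the tower ⟺ RM·L < (a + 1)L + 1** (k ≥ 2, L ≥ 1, η > 0). [cite: Balaban1984PropagatorsII, (2.2) p.224] -/
theorem twCS_cond22_iff (hk : 2 ≤ k) (hL : 1 ≤ L) (hη : 0 < η) :
    Cond22 (twCS d k a m L η R) (tposR L η) ↔ R * m * L < ((a : ℝ) + 1) * L + 1 := zoneSep_tposR_iff hk hL hη

/-- The walk form of (2.2) with the sharp constant: `LevelGap … (a + 1)` (L ≥ 1). [cite: Balaban1984PropagatorsII, (2.57) p.233] -/
theorem twCS_levelGap (hL : 1 ≤ L) : LevelGap (twCS d k a m L η R).bond (twCS d k a m L η R).zone (a + 1) :=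
  graph_levelGap hL

/-- The walk form of (2.2) BY THE PRINTED ROUTE (`…B6LevelGapMetric.levelGap_of_cond22`: (len) + (2.2) on lattice points
⇒ more than N bonds for any N ≤ RM), with (2.2) a hypothesis that `twCS_cond22` discharges. [cite: Balaban1984PropagatorsII, (2.2) p.224 + (2.57) p.233] -/
theorem twCS_levelGap_of_cond22 (hL : 1 ≤ L) (hη : 0 < η) (h22 : Cond22 (twCS d k a m L η R) (tposR L η)) {N : ℕ}
    (hN : (N : ℝ) ≤ R * m) : LevelGap (twCS d k a m L η R).bond (twCS d k a m L η R).zone N :=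
  levelGap_of_cond22 (tposR L η) (by show (1 : ℝ) ≤ (L : ℝ); exact_mod_cast hL) hη.le (twCS_bondScale22 d k a m L η R hη.le) h22 hN

/-- The walk form fails with a + 2 (k ≥ 2). [cite: Balaban1984PropagatorsII, (2.57) p.233] -/
theorem twCS_not_levelGap (hk : 2 ≤ k) : ¬ LevelGap (twCS d k a m L η R).bond (twCS d k a m L η R).zone (a + 2) :=
  graph_not_levelGap hk L

/-- hρ on the tower. [folklore] -/
theorem twGeo_isPseudoDist : IsPseudoDist (twGeo d k a m L η R).dist := isPseudoDist_tdist L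

/-- The three metric hypotheses of the (2.66)∕(2.76) chains ((2.54), d(y,y) = 0, d ≥ 0) on the tower, from the
realisation. [cite: Balaban1984PropagatorsII, (2.54) p.233 + (2.46) p.231] -/
theorem twGeo_hyps266 : Triangle254 (twGeo d k a m L η R) ∧ (∀ y, (twGeo d k a m L η R).dist y y = 0) ∧
    (∀ y y', 0 ≤ (twGeo d k a m L η R).dist y y') :=
  hyps266_of_realizes (twGeo_realizes d k a m L η R) (twCS_connected d k a m L η R)

/-- **The exponent of (2.60) is controlled with the constant a + 1**: (a + 1)·max{|j − j′| − 1, 0} ≤ d(y, y′) (L ≥ 1).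
[cite: Balaban1984PropagatorsII, (2.60) p.234 + (2.57) p.233] -/
theorem twGeo_dist_ge_levels (hL : 1 ≤ L) (y y' : TW d k a) :
    ((a : ℝ) + 1) * mx (twGeo d k a m L η R) y y' ≤ (twGeo d k a m L η R).dist y y' := dist_ge_levels hL y y'

/-- **`LevelSep` (the metric content RM·max{|j−j′|−1,0} ≤ d of (2.60)) HOLDS on the tower for RM ≤ a + 1** — with
R > 0 admissible. [cite: Balaban1984PropagatorsII, (2.60) p.234] -/
theorem twGeo_levelSep (hL : 1 ≤ L) (hRM : R * m ≤ (a : ℝ) + 1) : LevelSep (twGeo d k a m L η R) := by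
  intro y y'
  calc R * (m : ℝ) * mx (twGeo d k a m L η R) y y' ≤ ((a : ℝ) + 1) * mx (twGeo d k a m L η R) y y' :=
        mul_le_mul_of_nonneg_right hRM (mx_nonneg y y')
    _ ≤ (twGeo d k a m L η R).dist y y' := twGeo_dist_ge_levels d k a m L η R hL y y'

/-- The exponent max{|j − j′| − 1, 0} of (2.60) IS ATTAINED with value 1 on the tower (levels 0 and 2; k ≥ 2).
[cite: Balaban1984PropagatorsII, (2.60) p.234] -/
theorem twGeo_mx_wall2 (hk : 2 ≤ k) :
    mx (twGeo d k a m L η R) ((⟨0, Nat.succ_pos k⟩, cornerA d a) : TW d k a) (⟨2, by omega⟩, 0) = 1 := by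
  simp [mx, lvl]
  norm_num

/-- **`LevelSep` FAILS on the tower for RM > a + 2** (k ≥ 2): d(corner₀, corner₂) = a + 2 while the exponent is 1.
[cite: Balaban1984PropagatorsII, (2.60) p.234] -/
theorem twGeo_not_levelSep (hk : 2 ≤ k) (hRM : (a : ℝ) + 2 < R * m) : ¬ LevelSep (twGeo d k a m L η R) := by
  intro h
  have h1 := h ((⟨0, Nat.succ_pos k⟩, cornerA d a) : TW d k a) (⟨2, by omega⟩, 0)
  rw [twGeo_mx_wall2 d k a m L η R hk, mul_one] at h1
  have h2 : (twGeo d k a m L η R).dist ((⟨0, Nat.succ_pos k⟩, cornerA d a) : TW d k a) (⟨2, by omega⟩, 0) ≤ (a : ℝ) + 2 := by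
    show tdist L _ _ ≤ _
    unfold tdist
    exact_mod_cast dist_wall2_le (d := d) (k := k) (a := a) L ⟨0, Nat.succ_pos k⟩ ⟨1, by omega⟩ ⟨2, by omega⟩ rfl rfl
  linarith

/-- **(2.60) on the tower with R > 0 admissible**: for RM ≤ a + 1, L ≥ 1 and αδ₀ ≥ 0, e^{−αδ₀d(y,y′)} ≤
e^{−αδ₀RM max{|j−j′|−1,0}} — `…B6Geometry.ineq260_of_levelGap` with the walk form supplied by `twCS_levelGap` and
N = a + 1 ≥ RM. [cite: Balaban1984PropagatorsII, (2.60) p.234 + (2.2) p.224 + (2.57) p.233] -/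
theorem twGeo_ineq260 (hL : 1 ≤ L) (hRM : R * m ≤ (a : ℝ) + 1) {δ₀ α : ℝ} (hαδ : 0 ≤ α * δ₀) :
    Ineq260 (twGeo d k a m L η R) δ₀ α :=
  ineq260_of_levelGap (twGeo_realizes d k a m L η R) (twCS_connected d k a m L η R) (twCS_levelGap d k a m L η R hL)
    (N := a + 1) (by push_cast; exact hRM) hαδ

/-- **(2.60) on the tower BY THE PRINTED-SHAPE ROUTE** (`…B6LevelGapMetric.ineq260_of_cond22`: realisation + (len) +
(2.2) on lattice points + RM = N ∈ ℕ), with (2.2) a hypothesis that `twCS_cond22` DISCHARGES (it has content here).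
[cite: Balaban1984PropagatorsII, (2.60) p.234 + (2.2) p.224] -/
theorem twGeo_ineq260_of_cond22 (hL : 1 ≤ L) (hη : 0 < η) (h22 : Cond22 (twCS d k a m L η R) (tposR L η)) {N : ℕ}
    (hN : (N : ℝ) = R * m) {δ₀ α : ℝ} (hαδ : 0 ≤ α * δ₀) : Ineq260 (twGeo d k a m L η R) δ₀ α :=
  ineq260_of_cond22 (twGeo_realizes d k a m L η R) (twCS_connected d k a m L η R) (tposR L η)
    (by show (1 : ℝ) ≤ (L : ℝ); exact_mod_cast hL) hη.le (twCS_bondScale22 d k a m L η R hη.le) h22 hN hαδ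

/-- **(2.60) FAILS on the tower for RM > a + 2** at every rate αδ₀ > 0 (k ≥ 2): the R of (2.60) is load-bearing.
[cite: Balaban1984PropagatorsII, (2.60) p.234] -/
theorem twGeo_not_ineq260 (hk : 2 ≤ k) (hRM : (a : ℝ) + 2 < R * m) {δ₀ α : ℝ} (hαδ : 0 < α * δ₀) :
    ¬ Ineq260 (twGeo d k a m L η R) δ₀ α :=
  fun h => twGeo_not_levelSep d k a m L η R hk hRM ((levelSep_iff_ineq260 (g := twGeo d k a m L η R) hαδ).mpr h)

/-- **(2.2) at SET level on the tower** (`…B6LevelGapMetric.SetSep22` for the domains Ω_j = {levels ≥ j}), whenever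
RM·L < (a + 1)L + 1. [cite: Balaban1984PropagatorsII, (2.1)–(2.4) p.224] -/
theorem twCS_setSep22 (hL : 1 ≤ L) (hη : 0 < η) (hRM : R * m * L < ((a : ℝ) + 1) * L + 1) :
    SetSep22 (twCS d k a m L η R) dom (tposR L η) :=
  (setSep_dom_iff (tposR L η) _ _).mpr (twCS_cond22 d k a m L η R hL hη hRM)

/-- (2.60) on the tower from (2.1)–(2.4)-shaped data (`…B6LevelGapMetric.ineq260_of_setSep22`), RM = N ∈ ℕ.
[cite: Balaban1984PropagatorsII, (2.60) p.234 + (2.1)–(2.4) p.224] -/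
theorem twGeo_ineq260_of_setSep22 (hL : 1 ≤ L) (hη : 0 < η) (h22 : SetSep22 (twCS d k a m L η R) dom (tposR L η))
    {N : ℕ} (hN : (N : ℝ) = R * m) {δ₀ α : ℝ} (hαδ : 0 ≤ α * δ₀) : Ineq260 (twGeo d k a m L η R) δ₀ α :=
  ineq260_of_setSep22 (twGeo_realizes d k a m L η R) (twCS_connected d k a m L η R) dom (tposR L η) zonesOf_dom
    (by show (1 : ℝ) ≤ (L : ℝ); exact_mod_cast hL) hη.le (twCS_bondScale22 d k a m L η R hη.le) h22 hN hαδ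

/-- The in-box comparison of (2.66) on the tower: d(y, y″) ≤ ‖x − x″‖₁ for two sites of one level. [cite: Balaban1984PropagatorsII, (2.66) p.234 + (2.46) p.231] -/
theorem twGeo_dist_le_latL1Dist (z : Fin (k + 1)) (x x' : Fin d → Fin (a + 1)) :
    (twGeo d k a m L η R).dist (z, x) (z, x') ≤ (latL1Dist (zv x) (zv x') : ℝ) := by
  show tdist L _ _ ≤ _
  unfold tdist
  exact_mod_cast dist_le_latL1Dist_of_lvl L z x x'

end Geo

/-! ## §6  Non-vacuity: three levels, every hypothesis satisfiable, every conclusion with content -/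

/-- **The side conditions of §5 hold together and the conclusions are non-trivial**: d = 1, three levels (k = 2), a = 5
(six Λ_j-points across each block), M = 2, L = 2, η = 1.  With R = 3 (RM = 6 = a + 1): (2.2) on lattice points, the
walk form with N = 6, `LevelSep`, and (2.60) at αδ₀ = ½ all HOLD; with R = 4 (RM = 8 > a + 2): (2.2), `LevelSep` and
(2.60) all FAIL, and the walk form fails with N = 7 — so none of them is vacuous on this geometry.
[cite: Balaban1984PropagatorsII, (2.2) p.224 + (2.57) p.233 + (2.60) p.234] -/
theorem levelTower_nonvacuous :
    Cond22 (twCS 1 2 5 2 2 1 3) (tposR 2 1) ∧ ¬ Cond22 (twCS 1 2 5 2 2 1 4) (tposR 2 1) ∧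
    LevelGap (twCS 1 2 5 2 2 1 3).bond (twCS 1 2 5 2 2 1 3).zone 6 ∧
    ¬ LevelGap (twCS 1 2 5 2 2 1 3).bond (twCS 1 2 5 2 2 1 3).zone 7 ∧
    LevelSep (twGeo 1 2 5 2 2 1 3) ∧ ¬ LevelSep (twGeo 1 2 5 2 2 1 4) ∧
    Ineq260 (twGeo 1 2 5 2 2 1 3) 1 (1 / 2) ∧ ¬ Ineq260 (twGeo 1 2 5 2 2 1 4) 1 (1 / 2) := by
  refine ⟨twCS_cond22_of_le 1 2 5 2 2 1 3 (by norm_num) one_pos (by norm_num),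
    twCS_not_cond22 1 2 5 2 2 1 4 le_rfl one_pos (by norm_num),
    twCS_levelGap 1 2 5 2 2 1 3 (by norm_num),
    twCS_not_levelGap 1 2 5 2 2 1 3 le_rfl,
    twGeo_levelSep 1 2 5 2 2 1 3 (by norm_num) (by norm_num),
    twGeo_not_levelSep 1 2 5 2 2 1 4 le_rfl (by norm_num),
    twGeo_ineq260 1 2 5 2 2 1 3 (by norm_num) (by norm_num) (by norm_num),
    twGeo_not_ineq260 1 2 5 2 2 1 4 le_rfl (by norm_num) (by norm_num)⟩

end Literature.MathematicalPhysics.QuantumFieldTheory.Balaban1983to89.B6LevelTower
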